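import Literature.Computability.Complexity.CSPToCMMSA
import HarnessLib

/-!
# Complexity core: the Dinur–Safra reduction from gap CSPs to CMMSA, II — soundness

Second file on the instance map `CSPInstance.toCMMSA` of Hirahara's proof of Thm. 5.2
(`CSPToCMMSA.lean`): the **soundness analysis** (Hirahara 2022, proof of Thm. 5.2, pp. 17–18),
proved in full. For an assignment `L` of the literals let `A(x) := {a | L_{x,a} = 1}` and call a
constraint `Cⱼ` *heavy* (threshold `t`) if some variable `x ∈ dom Cⱼ` has `|A(x)| > t`.

* `heavyCount_mul_le_weightOf` — **Markov step**: `#{j | Cⱼ heavy} · (t + 1) ≤ w(L)`, because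
  `w(L) = Σⱼ Σ_{x ∈ dom Cⱼ} |A(x)|` (Eq. (4) and "`E_{x∼𝒟}[|A(x)|] ≤ g`");
* `exists_assignment_of_light` — **random assignment + averaging**: drawing `α(x) ∈ A(x)`
  uniformly and independently, a non-heavy `Cⱼ` with `φⱼ(L) = 1` is satisfied with probability
  `≥ t^{-D}`; hence some CSP assignment `α` has
  `#{j | φⱼ(L) = 1} ≤ #{j | Cⱼ heavy} + t^D · #{j | Cⱼ(α) = 1}`;
* `toCMMSA_sound` — the printed real form: if `w(L) ≤ g · s` (`s = mD`) and
  `Pr_j[φⱼ(L) = 1] ≥ ε`, then some assignment satisfies at least an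
  `(ε/2) · (ε/(2gD))^D`-fraction of the constraints (Hirahara takes `t = 2gD/ε`).

No new definitions: the heavy predicate is written `C.vars.any (t < |A(·)|)` and the random
assignments range over `Fintype.piFinset` of the family `A'(x)` (`A(x)`, or `{0}` when `A(x)`
is empty), extended by `0` outside `[n]`.

## References

* S. Hirahara, *NP-hardness of learning programs and partial MCSP*, FOCS 2022; ECCC TR22-119:
  proof of Thm. 5.2, pp. 17–18 (Eq. (3), Eq. (4), the distribution `𝒟`, Markov's inequality,
  the random assignment `α` and the averaging argument).
* I. Dinur, S. Safra, *On the hardness of approximating label-cover*, IPL 89 (2004).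
-/

namespace Literature.Computability.Complexity

open MetaComplexity Finset

namespace CSPInstance

/-! ### Markov step -/

/-- `Σ_{x < n} |Ψ_l(x)| · k(x) = Σ_{C ∈ l} Σ_{x ∈ dom C} k(x)` for constraints over `[n]`
(double counting along the distribution `𝒟` of the proof: "each variable `x` is chosen with
probability `|Ψ(x)| / mD`"). [cite: Hirahara2022PartialMCSP, proof of Thm. 5.2 (p. 17, Eq. (4) and the distribution 𝒟)] -/
theorem sum_countP_mem_mul_eq (l : List CSPConstraint) (n : ℕ) (k : ℕ → ℕ)
    (hl : ∀ C ∈ l, ∀ x ∈ C.vars, x < n) :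
    ∑ x ∈ range n, (l.countP fun C => x ∈ C.vars) * k x =
      (l.map fun C => ∑ x ∈ C.vars.toFinset, k x).sum := by
  induction l with
  | nil => simp
  | cons C l ih =>
    simp only [List.countP_cons, List.map_cons, List.sum_cons, add_mul, sum_add_distrib]
    rw [ih fun C' hC' => hl C' (by simp [hC']), add_comm]
    congr 1
    have hC : ∀ x ∈ C.vars, x < n := hl C (by simp)
    have hfilter : (range n).filter (fun x => x ∈ C.vars) = C.vars.toFinset := by
      ext x
      simp only [mem_filter, mem_range, List.mem_toFinset]
      exact ⟨fun h => h.2, fun h => ⟨hC x h, h⟩⟩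
    rw [← hfilter, sum_filter]
    refine sum_congr rfl fun x _ => ?_
    by_cases hx : x ∈ C.vars <;> simp [hx]

/-- **Markov step** (Hirahara 2022, proof of Thm. 5.2, p. 17: Eq. (4), `E_{x∼𝒟}[|A(x)|] ≤ g`,
and "by Markov's inequality … `Pr_{C∼Ψ}[|A(x)| ≥ 2gD/ε for some variable x in C] ≤ ε/2`"), in
counting form: the number of *heavy* constraints — those with a variable `x` of `|A(x)| > t` —
times `t + 1` is at most the weight `w(L) = Σ_x |Ψ(x)| · |A(x)|`. [cite: Hirahara2022PartialMCSP, proof of Thm. 5.2 (p. 17, Markov's inequality)] -/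
theorem heavyCount_mul_le_weightOf {Ψ : CSPInstance} (hwf : Ψ.WellFormed) (a : ℕ → Bool) (t : ℕ) :
    (Ψ.constraints.countP fun C => C.vars.any fun x => decide (t < Ψ.litCard a x)) * (t + 1) ≤
      Ψ.toCMMSA.weightOf a := by
  rw [weightOf_toCMMSA_eq]
  have hswap := sum_countP_mem_mul_eq Ψ.constraints Ψ.numVars (Ψ.litCard a)
    fun C hC x hx => (hwf.2 C hC).1 x hx
  unfold occCount
  rw [hswap]
  -- pointwise: a heavy constraint contributes at least `t + 1`
  have key : ∀ l : List CSPConstraint,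
      (l.countP fun C => C.vars.any fun x => decide (t < Ψ.litCard a x)) * (t + 1) ≤
        (l.map fun C => ∑ x ∈ C.vars.toFinset, Ψ.litCard a x).sum := by
    intro l
    induction l with
    | nil => simp
    | cons C l ih =>
      simp only [List.countP_cons, List.map_cons, List.sum_cons, add_mul]
      rw [add_comm]
      refine Nat.add_le_add ?_ ih
      by_cases h : (C.vars.any fun x => decide (t < Ψ.litCard a x)) = true
      · rw [if_pos h, one_mul]
        obtain ⟨x, hx, htx⟩ := List.any_eq_true.1 h
        have htx' : t < Ψ.litCard a x := by simpa using htx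
        calc t + 1 ≤ Ψ.litCard a x := htx'
          _ ≤ ∑ y ∈ C.vars.toFinset, Ψ.litCard a y :=
            single_le_sum (fun _ _ => Nat.zero_le _) (List.mem_toFinset.2 hx)
      · rw [if_neg h, zero_mul]
        exact Nat.zero_le _
  exact key _


/-! ### Random assignment and averaging -/

/-- **One light satisfied constraint** (Hirahara 2022, proof of Thm. 5.2, p. 17: "Under the event
that `r ∈ C⁻¹(1)`, `|A(x)| ≤ 2gD/ε`, and `r(x) ∈ A(x)` for every `x ∈ dom(r)`, we have
`C(α) = 1` if `α(x) = r(x)` for every `x ∈ dom(r)`, which happens with probability at least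
`(ε/2gD)^D`"), in counting form. The random assignments are the members of
`Fintype.piFinset A'` for any family `A'` with `A'(x) = A(x)` whenever `A(x) ≠ ∅`, extended
by `0` outside `[n]`; if `φ_C(L) = 1` and every variable of `C` has `|A(x)| ≤ t`, then at least
a `t^{-D}` fraction of them satisfies `C`. [cite: Hirahara2022PartialMCSP, proof of Thm. 5.2 (p. 17, the random assignment α)] -/
theorem card_piFinset_le_of_light {Ψ : CSPInstance} (hwf : Ψ.WellFormed) {D : ℕ}
    (hD : Ψ.HasArity D) (a : ℕ → Bool) (t : ℕ) {C : CSPConstraint} (hC : C ∈ Ψ.constraints)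
    (heval : (C.toMonotoneDNF Ψ.litWidth).eval a = true)
    (hlight : ∀ x ∈ C.vars, Ψ.litCard a x ≤ t) (A' : Fin Ψ.numVars → Finset ℕ)
    (hA' : ∀ x, (Ψ.litSet a x.1).Nonempty → A' x = Ψ.litSet a x.1) :
    (Fintype.piFinset A').card ≤
      t ^ D * ((Fintype.piFinset A').filter fun σ =>
        C.IsSatisfiedBy (fun y => if h : y < Ψ.numVars then σ ⟨y, h⟩ else 0) = true).card := by
  obtain ⟨hvars, hnodup, -, hrows⟩ := hwf.2 C hC
  have hlen : C.vars.length = D := hD C hC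
  obtain ⟨r, hr, hra⟩ := (CSPConstraint.eval_toMonotoneDNF_eq_true_iff _ _ _).1 heval
  obtain ⟨hrlen, hrval⟩ := hrows r hr
  -- the values of `r` lie in the sets `A(x)`
  have hrA : ∀ (i : ℕ) (hi : i < C.vars.length),
      r[i]'(hrlen ▸ hi) ∈ Ψ.litSet a C.vars[i] := fun i hi =>
    mem_litSet.2 ⟨(hrval _ (List.getElem_mem _)).trans_le Ψ.alphabetSize_le_litWidth,
      hra i hi (hrlen ▸ hi)⟩
  -- the sub-family pinning the variables of `C` to their `r`-values
  let A'' : Fin Ψ.numVars → Finset ℕ := fun x =>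
    if hx : x.1 ∈ C.vars then
      {r[C.vars.idxOf x.1]'(by rw [hrlen]; exact List.idxOf_lt_length_of_mem hx)}
    else A' x
  have hpin : ∀ x : Fin Ψ.numVars, ∀ hx : x.1 ∈ C.vars,
      r[C.vars.idxOf x.1]'(by rw [hrlen]; exact List.idxOf_lt_length_of_mem hx) ∈
        Ψ.litSet a x.1 := by
    intro x hx
    have hi := List.idxOf_lt_length_of_mem hx
    have hmem := hrA (C.vars.idxOf x.1) hi
    simp only [List.getElem_idxOf hi] at hmem
    exact hmem
  have hsub : ∀ x, A'' x ⊆ A' x := by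
    intro x
    simp only [A'']
    split_ifs with hx
    · have hmem := hpin x hx
      rw [hA' x ⟨_, hmem⟩]
      exact Finset.singleton_subset_iff.2 hmem
    · exact Finset.Subset.refl _
  -- every pinned assignment satisfies `C`
  have hsat : ∀ σ ∈ Fintype.piFinset A'',
      C.IsSatisfiedBy (fun y => if h : y < Ψ.numVars then σ ⟨y, h⟩ else 0) = true := by
    intro σ hσ
    rw [Fintype.mem_piFinset] at hσ
    rw [CSPConstraint.isSatisfiedBy_eq_true_iff]
    have hmap : C.vars.map (fun y => if h : y < Ψ.numVars then σ ⟨y, h⟩ else 0) = r := by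
      refine List.ext_getElem (by simp [hrlen]) fun i h₁ h₂ => ?_
      rw [List.length_map] at h₁
      have hx : C.vars[i] < Ψ.numVars := hvars _ (List.getElem_mem h₁)
      have hmemv : C.vars[i] ∈ C.vars := List.getElem_mem h₁
      have hσi := hσ ⟨C.vars[i], hx⟩
      simp only [A'', dif_pos hmemv, Finset.mem_singleton] at hσi
      simp only [List.getElem_map, dif_pos hx, hσi]
      congr 1
      exact hnodup.idxOf_getElem i h₁
    rw [hmap]
    exact hr
  have hfilter : Fintype.piFinset A'' ⊆ (Fintype.piFinset A').filter fun σ =>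
      C.IsSatisfiedBy (fun y => if h : y < Ψ.numVars then σ ⟨y, h⟩ else 0) = true := by
    intro σ hσ
    exact Finset.mem_filter.2 ⟨Fintype.piFinset_subset _ _ hsub hσ, hsat σ hσ⟩
  -- counting: the variables of `C` as a finset of `Fin n` of cardinality `D`
  let V : Finset (Fin Ψ.numVars) := univ.filter fun x => x.1 ∈ C.vars
  have hVmap : V.map Fin.valEmbedding = C.vars.toFinset := by
    ext y
    simp only [V, Finset.mem_map, Finset.mem_filter, Finset.mem_univ, true_and,
      Fin.valEmbedding_apply, List.mem_toFinset]
    constructor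
    · rintro ⟨x, hx, rfl⟩
      exact hx
    · intro hy
      exact ⟨⟨y, hvars y hy⟩, hy, rfl⟩
  have hVcard : V.card = D := by
    rw [← Finset.card_map Fin.valEmbedding, hVmap, List.toFinset_card_of_nodup hnodup, hlen]
  have hprodV : ∏ x ∈ V, (A' x).card ≤ t ^ D := by
    rw [← hVcard]
    refine Finset.prod_le_pow_card _ _ _ fun x hx => ?_
    have hxv : x.1 ∈ C.vars := (Finset.mem_filter.1 hx).2
    rw [hA' x ⟨_, hpin x hxv⟩]
    exact hlight _ hxv
  have hprodV'' : ∏ x ∈ V, (A'' x).card = 1 := by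
    refine Finset.prod_eq_one fun x hx => ?_
    have hxv : x.1 ∈ C.vars := (Finset.mem_filter.1 hx).2
    simp [A'', dif_pos hxv]
  have hrest : ∏ x ∈ univ.filter (fun x : Fin Ψ.numVars => ¬ x.1 ∈ C.vars), (A'' x).card =
      ∏ x ∈ univ.filter (fun x : Fin Ψ.numVars => ¬ x.1 ∈ C.vars), (A' x).card := by
    refine Finset.prod_congr rfl fun x hx => ?_
    have hxv : ¬ x.1 ∈ C.vars := (Finset.mem_filter.1 hx).2
    simp [A'', dif_neg hxv]
  have hcard' : (Fintype.piFinset A').card =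
      (∏ x ∈ V, (A' x).card) *
        ∏ x ∈ univ.filter (fun x : Fin Ψ.numVars => ¬ x.1 ∈ C.vars), (A' x).card := by
    rw [Fintype.card_piFinset, ← Finset.prod_filter_mul_prod_filter_not univ fun x => x.1 ∈ C.vars]
  have hcard'' : (Fintype.piFinset A'').card =
      ∏ x ∈ univ.filter (fun x : Fin Ψ.numVars => ¬ x.1 ∈ C.vars), (A' x).card := by
    rw [Fintype.card_piFinset, ← Finset.prod_filter_mul_prod_filter_not univ fun x => x.1 ∈ C.vars,
      hprodV'', one_mul, hrest]
  calc (Fintype.piFinset A').card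
      = (∏ x ∈ V, (A' x).card) *
          ∏ x ∈ univ.filter (fun x : Fin Ψ.numVars => ¬ x.1 ∈ C.vars), (A' x).card := hcard'
    _ ≤ t ^ D * ∏ x ∈ univ.filter (fun x : Fin Ψ.numVars => ¬ x.1 ∈ C.vars), (A' x).card :=
        Nat.mul_le_mul_right _ hprodV
    _ = t ^ D * (Fintype.piFinset A'').card := by rw [hcard'']
    _ ≤ t ^ D * _ := Nat.mul_le_mul_left _ (Finset.card_le_card hfilter)


/-- Exchanging the sum over random assignments with the count over constraints:
`Σ_σ #{C ∈ l | P σ C} = Σ_{C ∈ l} #{σ | P σ C}`. [folklore] -/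
theorem sum_countP_eq_sum_map_card {α β : Type*} (S : Finset β) (l : List α) (P : β → α → Bool) :
    ∑ s ∈ S, l.countP (P s) = (l.map fun x => (S.filter fun s => P s x = true).card).sum := by
  induction l with
  | nil => simp
  | cons x l ih =>
    simp only [List.countP_cons, sum_add_distrib, ih, List.map_cons, List.sum_cons]
    rw [add_comm, Finset.card_filter]

/-- Weighted counting: if every `x ∈ l` with `p x` has `N ≤ c · g x` then
`#{x ∈ l | p x} · N ≤ c · Σ_{x ∈ l} g x`. [folklore] -/
theorem countP_mul_le_mul_sum_map {α : Type*} (l : List α) (p : α → Bool) (g : α → ℕ) (N c : ℕ)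
    (h : ∀ x ∈ l, p x = true → N ≤ c * g x) : l.countP p * N ≤ c * (l.map g).sum := by
  induction l with
  | nil => simp
  | cons x l ih =>
    simp only [List.countP_cons, List.map_cons, List.sum_cons, add_mul, mul_add]
    rw [add_comm (c * g x)]
    refine Nat.add_le_add (ih fun y hy => h y (by simp [hy])) ?_
    by_cases hx : p x = true
    · rw [if_pos hx, one_mul]
      exact h x (by simp) hx
    · rw [if_neg hx, zero_mul]
      exact Nat.zero_le _

/-- `#{x | p x} ≤ #{x | q x} + #{x | r x}` when `p → q ∨ r` on `l`. [folklore] -/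
theorem countP_le_countP_add_countP {α : Type*} (l : List α) (p q r : α → Bool)
    (h : ∀ x ∈ l, p x = true → q x = true ∨ r x = true) :
    l.countP p ≤ l.countP q + l.countP r := by
  induction l with
  | nil => simp
  | cons x l ih =>
    simp only [List.countP_cons]
    have ih' := ih fun y hy => h y (by simp [hy])
    by_cases hp : p x = true
    · rcases h x (by simp) hp with hq | hr
      · rw [if_pos hp, if_pos hq]; split_ifs <;> omega
      · rw [if_pos hp, if_pos hr]; split_ifs <;> omega
    · rw [if_neg hp]; split_ifs <;> omega

/-- **Random assignment and averaging** (Hirahara 2022, proof of Thm. 5.2, pp. 17–18: "we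
construct a random assignment `α : [n] → Σ` as follows: For each `x ∈ [n]`, pick `a ∼ A(x)`
uniformly and randomly and define `α(x) := a`. … It follows that
`Pr_{C∼Ψ, α}[C(α) = 1] ≥ ε/2 · (ε/2gD)^D`. By an averaging argument, there exists an
assignment `α` …"), in counting form with threshold `t`: for every assignment `L` of the
literals there is a CSP assignment `α` with
`#{j | φⱼ(L) = 1} ≤ #{j | Cⱼ heavy} + t^D · #{j | Cⱼ(α) = 1}`.
[cite: Hirahara2022PartialMCSP, proof of Thm. 5.2 (pp. 17–18, random assignment and averaging)] -/
theorem exists_assignment_of_light {Ψ : CSPInstance} (hwf : Ψ.WellFormed) {D : ℕ}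
    (hD : Ψ.HasArity D) (a : ℕ → Bool) (t : ℕ) :
    ∃ σ : ℕ → ℕ, Ψ.toCMMSA.satCount a ≤
      (Ψ.constraints.countP fun C => C.vars.any fun x => decide (t < Ψ.litCard a x)) +
        t ^ D * Ψ.satCount σ := by
  -- the family `A'(x)` of candidate values and the random assignments `S`
  let A' : Fin Ψ.numVars → Finset ℕ := fun x =>
    if (Ψ.litSet a x.1).Nonempty then Ψ.litSet a x.1 else {0}
  have hA' : ∀ x, (Ψ.litSet a x.1).Nonempty → A' x = Ψ.litSet a x.1 := fun x hx => if_pos hx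
  have hA'ne : ∀ x, (A' x).Nonempty := fun x => by
    by_cases hx : (Ψ.litSet a x.1).Nonempty
    · simpa only [A', if_pos hx] using hx
    · simp only [A', if_neg hx, Finset.singleton_nonempty]
  set S : Finset (Fin Ψ.numVars → ℕ) := Fintype.piFinset A' with hS
  have hSne : S.Nonempty := Fintype.piFinset_nonempty.2 hA'ne
  let e : (Fin Ψ.numVars → ℕ) → ℕ → ℕ := fun σ y => if h : y < Ψ.numVars then σ ⟨y, h⟩ else 0
  let heavy : CSPConstraint → Bool := fun C => C.vars.any fun x => decide (t < Ψ.litCard a x)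
  let good : CSPConstraint → Bool := fun C => (C.toMonotoneDNF Ψ.litWidth).eval a && !heavy C
  -- averaging: good constraints are satisfied by a `t^{-D}` fraction of `S`
  have havg : Ψ.constraints.countP good * S.card ≤ t ^ D * ∑ σ ∈ S, Ψ.satCount (e σ) := by
    have hswap := sum_countP_eq_sum_map_card S Ψ.constraints fun σ C => C.IsSatisfiedBy (e σ)
    unfold satCount
    rw [hswap]
    refine countP_mul_le_mul_sum_map _ _ _ _ _ fun C hC hgood => ?_
    simp only [good, heavy, Bool.and_eq_true, Bool.not_eq_true', List.any_eq_false,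
      decide_eq_true_eq, not_lt] at hgood
    exact card_piFinset_le_of_light hwf hD a t hC hgood.1 hgood.2 A' hA'
  -- pigeonhole over `S`
  have hsum : ∑ σ ∈ S, Ψ.constraints.countP good ≤ ∑ σ ∈ S, t ^ D * Ψ.satCount (e σ) := by
    rw [Finset.sum_const, smul_eq_mul, ← Finset.mul_sum, mul_comm]
    exact havg
  obtain ⟨σ, -, hσ⟩ := Finset.exists_le_of_sum_le hSne hsum
  refine ⟨e σ, le_trans ?_ (Nat.add_le_add_left hσ _)⟩
  -- a satisfied formula is heavy or good
  unfold CMMSAInstance.satCount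
  rw [toCMMSA_formulas, List.countP_map]
  refine countP_le_countP_add_countP _ _ _ _ fun C _ hC => ?_
  simp only [Function.comp_apply] at hC
  by_cases hh : heavy C = true
  · exact Or.inl hh
  · refine Or.inr ?_
    simp only [good, Bool.and_eq_true, Bool.not_eq_true']
    exact ⟨hC, by simpa using hh⟩


/-- **Soundness of the reduction, printed form** (Hirahara 2022, proof of Thm. 5.2, pp. 17–18:
"Assume that there exists an assignment `L` such that `w(L) = g · mD` and
`Pr_{j∼[m]}[φⱼ(L) = 1] ≥ ε` … By an averaging argument, there exists an assignment
`α : [n] → Σ` that satisfies a `ε/2 · (ε/2gD)^D`-fraction of constraints in `Ψ`"): for a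
well-formed instance of arity `D ≥ 1`, an assignment of the literals of weight `≤ g · s`
(`s = mD`) satisfying at least `ε · m` of the formulas `φⱼ` yields a CSP assignment satisfying
at least `(ε/2) · (ε/(2gD))^D · m` constraints (take `t = ⌊2gD/ε⌋` in
`heavyCount_mul_le_weightOf` and `exists_assignment_of_light`). [cite: Hirahara2022PartialMCSP, proof of Thm. 5.2 (pp. 17–18, soundness)] -/
theorem toCMMSA_sound {Ψ : CSPInstance} (hwf : Ψ.WellFormed) {D : ℕ} (hD : Ψ.HasArity D)
    (hDpos : 0 < D) {g ε : ℝ} (hg : 0 < g) (hε : 0 < ε) (a : ℕ → Bool)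
    (hw : (Ψ.toCMMSA.weightOf a : ℝ) ≤ g * Ψ.toCMMSA.threshold)
    (hsat : ε * Ψ.numConstraints ≤ Ψ.toCMMSA.satCount a) :
    ∃ σ : ℕ → ℕ, ε / 2 * (ε / (2 * g * D)) ^ D * Ψ.numConstraints ≤ Ψ.satCount σ := by
  have hmpos : (0 : ℝ) < Ψ.numConstraints := by exact_mod_cast hwf.1
  have hDr : (0 : ℝ) < D := by exact_mod_cast hDpos
  have hthr : (Ψ.toCMMSA.threshold : ℝ) = Ψ.numConstraints * D := by
    rw [toCMMSA_threshold, totalArity_eq_of_hasArity hD]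
    push_cast
    ring
  -- the threshold `T = 2gD/ε` and its integer part `t`
  set T : ℝ := 2 * g * D / ε with hT
  have hTpos : 0 < T := by positivity
  set t : ℕ := ⌊T⌋₊ with ht
  have htT : (t : ℝ) ≤ T := Nat.floor_le hTpos.le
  have hTt : T ≤ (t : ℝ) + 1 := (Nat.lt_floor_add_one T).le
  -- Markov: few heavy constraints
  set H : ℕ := Ψ.constraints.countP fun C => C.vars.any fun x => decide (t < Ψ.litCard a x)
    with hH
  have hHle : (H : ℝ) ≤ ε * Ψ.numConstraints / 2 := by
    have h1 : ((H * (t + 1) : ℕ) : ℝ) ≤ Ψ.toCMMSA.weightOf a := by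
      exact_mod_cast heavyCount_mul_le_weightOf hwf a t
    push_cast at h1
    have h2 : (H : ℝ) * T ≤ g * (Ψ.numConstraints * D) := by
      calc (H : ℝ) * T ≤ H * (t + 1) := mul_le_mul_of_nonneg_left hTt (Nat.cast_nonneg _)
        _ ≤ Ψ.toCMMSA.weightOf a := h1
        _ ≤ g * (Ψ.numConstraints * D) := by rw [← hthr]; exact hw
    have h3 : (H : ℝ) ≤ g * (Ψ.numConstraints * D) / T := (le_div_iff₀ hTpos).2 h2
    have h4 : g * (Ψ.numConstraints * D) / T = ε * Ψ.numConstraints / 2 := by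
      rw [hT]
      field_simp
    rwa [h4] at h3
  -- averaging
  obtain ⟨σ, hσ⟩ := exists_assignment_of_light hwf hD a t
  have hσr : (Ψ.toCMMSA.satCount a : ℝ) ≤ H + (t : ℝ) ^ D * Ψ.satCount σ := by
    exact_mod_cast hσ
  have hkey : ε * Ψ.numConstraints / 2 ≤ (t : ℝ) ^ D * Ψ.satCount σ := by linarith
  refine ⟨σ, ?_⟩
  rcases Nat.eq_zero_or_pos t with ht0 | htpos
  · -- `t = 0`: then `t ^ D = 0` and `ε m / 2 ≤ 0`, impossible
    exfalso
    rw [ht0, Nat.cast_zero, zero_pow hDpos.ne', zero_mul] at hkey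
    nlinarith
  · have htr : (0 : ℝ) < t := by exact_mod_cast htpos
    have htD : (0 : ℝ) < (t : ℝ) ^ D := pow_pos htr D
    have hTD : (t : ℝ) ^ D ≤ T ^ D := pow_le_pow_left₀ htr.le htT D
    calc ε / 2 * (ε / (2 * g * D)) ^ D * Ψ.numConstraints
        = ε * Ψ.numConstraints / 2 / T ^ D := by
          rw [hT, div_pow, div_pow]
          field_simp
      _ ≤ ε * Ψ.numConstraints / 2 / (t : ℝ) ^ D :=
          div_le_div_of_nonneg_left (by positivity) htD hTD
      _ ≤ Ψ.satCount σ := by rw [div_le_iff₀ htD]; linarith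

end CSPInstance

end Literature.Computability.Complexity
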